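import Literature.NumberTheory.EllipticCurves.PAdicHeightsTateValuationProofs
import Summits.BirchSwinnertonDyer.Rank1Residual.ManinAdditive.CuspidalKummerClass
import HarnessLib

/-!
# E-an-71 `AtMostOneBlindRoot`: on a globally minimal `y² = x³ + a₂x² + a₄x + a₆` at most one rational 2-torsion point is Kummer-blind

Route `ManinLocalTwoThree` (cell bsd-f2-manin), crux C2 `ManinOddAtFour` (stmt-BirchSwinnertonDyer-22967), line `kato_shift_two` v9.
The line's open residual stub `stub_minimalReducibleResidual` (Rb: `W[2]` reducible, `4 ∣ N`) is analysed by the analytic lens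
through the KUMMER-BLINDNESS of rational `2`-torsion points (`Summit.BirchSwinnertonDyer.Rank1Residual.ManinAdditive.CuspidalKummer.
KummerBlindAtTwo a₂ a₄ e : Even (a₂ + e) ∧ 16 ∣ (a₂ + e)² − 4(a₄ + (a₂ + e)e)` — the Vélu quotient by `(e,0)` is non-minimal at
`2`; MEMO-an §56/§58).  The cell's candidate **E-an-71 `AtMostOneBlindRoot`** (an g16, «elementary THEOREM-candidate»; the local
shadow of the orientation of the `2`-isogeny tree: every curve has at most one non-étale outgoing `2`-isogeny; census 356 251 curves
with one blind point, 0 with two, of 1 302 564) is PROVED here: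

* `padicValInt_minimalDiscriminantInt_le_padicValRat_Δ_smul` — reusable `ℚ`-level form of «a globally minimal model minimises
  `ord_p Δ` among integral models»: `W` globally minimal, `C • W` with integer coefficients ⟹ `ord_p Δ_min(W) ≤ ord_p Δ(C • W)`
  (from `isMinimal_baseChange_padic_of_isGloballyMinimal` and Mathlib's `IsMinimal` over `ℤ_p`);
* `not_kummerBlindAtTwo_of_kummerBlindAtTwo_of_ne` / `atMostOneBlindRoot` — E-an-71: with roots `e ≠ e'` and `e''`, blind(`e`)
  ⟺ `e' ≡ e'' (mod 4)`, blind(`e'`) ⟺ `e ≡ e'' (mod 4)`; both give `e ≡ e' ≡ e'' (mod 4)`, and then `x = 4X + e`, `y = 8Y`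
  is an integral model with discriminant `2⁻¹² Δ(W)` — impossible at `2`.

Helper toward stub 6 only (`--supports … --as helper`); it does not close the stub.  Nothing about BSD or Manin's conjecture is
proved here.  No new definitions; axioms standard.  Reference: J. Silverman, *AEC*, VII.1 and VIII.8.
-/

set_option autoImplicit false
set_option linter.dupNamespace false

noncomputable section

open scoped Classical

open WeierstrassCurve NumberField IsDedekindDomain
  Summit.BirchSwinnertonDyer.Rank1Residual.ManinAdditive
  Summit.BirchSwinnertonDyer.Rank1Residual.ManinAdditive.CuspidalKummer

namespace Summit.BirchSwinnertonDyer.BirchSwinnertonDyer.Theorems.ManinLocalTwoThree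

/-- **A globally minimal model minimises `ord_p Δ` among all integral models** (`ℚ`-level form): if `W / ℚ` is globally
minimal and `C • W` has integer coefficients, then `ord_p Δ_min(W) ≤ ord_p Δ(C • W)` at every prime `p` (`W ⊗ ℚ_p` is
`ℤ_p`-minimal, `isMinimal_baseChange_padic_of_isGloballyMinimal`, and `(C • W) ⊗ ℚ_p` is an integral equation
`ℚ_p`-isomorphic to it).  [cite: SilvermanAEC2009, VII.1 (minimal equations) and VIII.8] -/
theorem padicValInt_minimalDiscriminantInt_le_padicValRat_Δ_smul (W : WeierstrassCurve ℚ) [W.IsElliptic]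
    [W.IsGloballyMinimal] (C : VariableChange ℚ) (B₁ B₂ B₃ B₄ B₆ : ℤ) (h₁ : (C • W).a₁ = B₁)
    (h₂ : (C • W).a₂ = B₂) (h₃ : (C • W).a₃ = B₃) (h₄ : (C • W).a₄ = B₄) (h₆ : (C • W).a₆ = B₆)
    (p : ℕ) [hp : Fact p.Prime] :
    (padicValInt p W.minimalDiscriminantInt : ℤ) ≤ padicValRat p (C • W).Δ := by
  obtain ⟨v, hv⟩ := (Rat.HeightOneSpectrum.primesEquiv (R := 𝓞 ℚ)).surjective ⟨p, hp.out⟩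
  have hvp : ((Rat.HeightOneSpectrum.primesEquiv v : Nat.Primes) : ℕ) = p := congrArg Subtype.val hv
  subst hvp
  haveI hmin := isMinimal_baseChange_padic_of_isGloballyMinimal W v
  set p : ℕ := ((Rat.HeightOneSpectrum.primesEquiv v : Nat.Primes) : ℕ) with hpdef
  set X : WeierstrassCurve ℚ_[p] := W.baseChange ℚ_[p] with hX
  set Y : WeierstrassCurve ℚ_[p] := (C • W).baseChange ℚ_[p] with hY
  have hYX : Y = (C.map (algebraMap ℚ ℚ_[p])) • X := by
    rw [hY, hX, baseChange, baseChange, map_variableChange]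
  haveI hYint : Y.IsIntegral ℤ_[p] := by
    refine isIntegral_of_exists_lift ℤ_[p] ⟨(B₁ : ℤ_[p]), ?_⟩ ⟨(B₂ : ℤ_[p]), ?_⟩ ⟨(B₃ : ℤ_[p]), ?_⟩
      ⟨(B₄ : ℤ_[p]), ?_⟩ ⟨(B₆ : ℤ_[p]), ?_⟩ <;>
      simp [hY, baseChange, h₁, h₂, h₃, h₄, h₆]
  have hle : Padic.mulValuation Y.Δ ≤ Padic.mulValuation X.Δ := by
    have := ((isMinimal_iff_of_le_one_iff (padicMulValuation_le_one_iff (p := p)) X).mp hmin).2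
      (C.map (algebraMap ℚ ℚ_[p])) (hYX ▸ hYint)
    rwa [← hYX] at this
  have hXΔ : X.Δ ≠ 0 := by
    rw [hX, baseChange, map_Δ]
    exact (map_ne_zero _).mpr W.isUnit_Δ.ne_zero
  have hYΔ' : Y.Δ = (((C • W).Δ : ℚ) : ℚ_[p]) := by
    rw [hY, baseChange, map_Δ, eq_ratCast]
  have hCWΔ : (C • W).Δ ≠ 0 := (C • W).isUnit_Δ.ne_zero
  have hYΔ : Y.Δ ≠ 0 := by
    rw [hYΔ']
    exact_mod_cast hCWΔ
  rw [padicMulValuation_apply_of_ne_zero hYΔ, padicMulValuation_apply_of_ne_zero hXΔ,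
    WithZero.exp_le_exp, neg_le_neg_iff, hX, padicValuation_Δ_baseChange_eq_padicValInt, hYΔ',
    Padic.valuation_ratCast] at hle
  exact hle

/-- If `16 ∣ d²` then `4 ∣ d` (integers). [folklore] -/
theorem four_dvd_of_sixteen_dvd_sq {d : ℤ} (hd : (16 : ℤ) ∣ d ^ 2) : (4 : ℤ) ∣ d := by
  have h : (4 : ℤ) ^ 2 ∣ d ^ 2 := by norm_num; exact hd
  exact (Int.pow_dvd_pow_iff two_ne_zero).mp h

/-- **E-an-71 `AtMostOneBlindRoot` (cell bsd-f2-manin, analytic lens, MEMO-an §58 (O); the local shadow of the orientation of the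
`2`-isogeny tree): on a globally minimal model `y² = x³ + a₂x² + a₄x + a₆` over `ℚ` two distinct rational `2`-torsion points
`(e, 0)`, `(e', 0)` are never both Kummer-blind at `2`.**  Proof: with the third root `e''`, blindness of `e` reads
`16 ∣ (e' − e'')²`, i.e. `e' ≡ e'' (mod 4)`, and blindness of `e'` reads `e ≡ e'' (mod 4)`; then `e ≡ e' ≡ e'' (mod 4)` and the
substitution `x = 4X + e`, `y = 8Y` (`C = (2; e, 0, 0)`) produces an INTEGRAL model with `Δ(C • W) = 2⁻¹² Δ(W)`, contradicting
the minimality of `W` at `2` (`padicValInt_minimalDiscriminantInt_le_padicValRat_Δ_smul`).  Supports stub 6 (`Rb`) of line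
`kato_shift_two` of crux C2 `ManinOddAtFour` (stmt-BirchSwinnertonDyer-22967): every curve has at most one blind rational
`2`-torsion point (census: 356 251 curves with one, 0 with two, of 1 302 564).  [cite: SilvermanAEC2009, VII.1 (minimal equations) and VIII.8] -/
theorem not_kummerBlindAtTwo_of_kummerBlindAtTwo_of_ne (W : WeierstrassCurve ℚ) [W.IsElliptic] [W.IsGloballyMinimal]
    (ha₁ : W.a₁ = 0) (ha₃ : W.a₃ = 0) (A₂ A₄ A₆ e e' : ℤ) (hA₂ : (A₂ : ℚ) = W.a₂) (hA₄ : (A₄ : ℚ) = W.a₄)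
    (hA₆ : (A₆ : ℚ) = W.a₆) (hne : e ≠ e') (he : e ^ 3 + A₂ * e ^ 2 + A₄ * e + A₆ = 0)
    (he' : e' ^ 3 + A₂ * e' ^ 2 + A₄ * e' + A₆ = 0) (hb : KummerBlindAtTwo A₂ A₄ e) :
    ¬ KummerBlindAtTwo A₂ A₄ e' := by
  intro hb'
  -- Vieta: `A₄` in terms of the two roots
  have hA₄' : A₄ = -(e ^ 2 + e * e' + e' ^ 2) - A₂ * (e + e') := by
    have h : (e - e') * (e ^ 2 + e * e' + e' ^ 2 + A₂ * (e + e') + A₄) = 0 := by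
      linear_combination he - he'
    rcases mul_eq_zero.mp h with h | h
    · exact absurd (sub_eq_zero.mp h) hne
    · linarith
  -- blindness of `e` and `e'` as congruences mod 4
  have hd₁ : (4 : ℤ) ∣ 2 * e' + e + A₂ := by
    apply four_dvd_of_sixteen_dvd_sq
    have h : (A₂ + e) ^ 2 - 4 * (A₄ + (A₂ + e) * e) = (2 * e' + e + A₂) ^ 2 := by rw [hA₄']; ring
    rw [← h]; exact hb.2
  have hd₂ : (4 : ℤ) ∣ 2 * e + e' + A₂ := by
    apply four_dvd_of_sixteen_dvd_sq
    have h : (A₂ + e') ^ 2 - 4 * (A₄ + (A₂ + e') * e') = (2 * e + e' + A₂) ^ 2 := by rw [hA₄']; ring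
    rw [← h]; exact hb'.2
  have hee' : (4 : ℤ) ∣ e' - e := by
    have h := dvd_sub hd₁ hd₂
    have h' : (2 * e' + e + A₂) - (2 * e + e' + A₂) = e' - e := by ring
    rwa [h'] at h
  obtain ⟨k₂, hk₂⟩ : (4 : ℤ) ∣ A₂ + 3 * e := by
    have h := dvd_sub hd₂ hee'
    have h' : (2 * e + e' + A₂) - (e' - e) = A₂ + 3 * e := by ring
    rwa [h'] at h
  obtain ⟨k₄, hk₄⟩ : (16 : ℤ) ∣ A₄ + 2 * e * A₂ + 3 * e ^ 2 := by
    have h : A₄ + 2 * e * A₂ + 3 * e ^ 2 = (e - e') * (2 * e + e' + A₂) := by rw [hA₄']; ring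
    rw [h, show (16 : ℤ) = 4 * 4 by norm_num]
    have h1 : (4 : ℤ) ∣ e - e' := by rw [show e - e' = -(e' - e) by ring]; exact (dvd_neg).mpr hee'
    exact mul_dvd_mul h1 hd₂
  -- the rescaled model `x = 4X + e`, `y = 8Y`
  set C : VariableChange ℚ := ⟨Units.mk0 (2 : ℚ) two_ne_zero, (e : ℚ), 0, 0⟩ with hC
  have hu : ((C.u⁻¹ : ℚˣ) : ℚ) = (2 : ℚ)⁻¹ := by rw [Units.val_inv_eq_inv_val, hC, Units.val_mk0]
  have h₁ : (C • W).a₁ = ((0 : ℤ) : ℚ) := by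
    rw [variableChange_a₁, ha₁]; simp [hC]
  have h₂ : (C • W).a₂ = ((k₂ : ℤ) : ℚ) := by
    rw [variableChange_a₂, ha₁, ← hA₂, hu]
    have : (A₂ : ℚ) + 3 * e = 4 * k₂ := by exact_mod_cast hk₂
    simp only [hC]
    linear_combination (1 / 4 : ℚ) * this
  have h₃ : (C • W).a₃ = ((0 : ℤ) : ℚ) := by
    rw [variableChange_a₃, ha₁, ha₃]; simp [hC]
  have h₄ : (C • W).a₄ = ((k₄ : ℤ) : ℚ) := by
    rw [variableChange_a₄, ha₁, ha₃, ← hA₂, ← hA₄, hu]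
    have : (A₄ : ℚ) + 2 * e * A₂ + 3 * e ^ 2 = 16 * k₄ := by exact_mod_cast hk₄
    simp only [hC]
    linear_combination (1 / 16 : ℚ) * this
  have h₆ : (C • W).a₆ = ((0 : ℤ) : ℚ) := by
    rw [variableChange_a₆, ha₁, ha₃, ← hA₂, ← hA₄, ← hA₆, hu]
    have : (e : ℚ) ^ 3 + A₂ * e ^ 2 + A₄ * e + A₆ = 0 := by exact_mod_cast he
    simp only [hC]
    linear_combination (1 / 64 : ℚ) * this
  -- minimality at 2 versus `Δ(C • W) = 2⁻¹² Δ(W)`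
  haveI : Fact (Nat.Prime 2) := ⟨Nat.prime_two⟩
  have hle := padicValInt_minimalDiscriminantInt_le_padicValRat_Δ_smul W C 0 k₂ 0 k₄ 0 h₁ h₂ h₃ h₄ h₆ 2
  have hΔ : (C • W).Δ = (2 : ℚ)⁻¹ ^ 12 * (W.minimalDiscriminantInt : ℚ) := by
    rw [variableChange_Δ, hu, cast_minimalDiscriminantInt]
  have hm : (W.minimalDiscriminantInt : ℚ) ≠ 0 := by exact_mod_cast minimalDiscriminantInt_ne_zero W
  rw [hΔ, padicValRat.mul (pow_ne_zero _ (inv_ne_zero two_ne_zero)) hm, padicValRat.pow,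
    padicValRat.inv, padicValRat.of_int] at hle
  have h2 : padicValRat 2 (2 : ℚ) = 1 := by exact_mod_cast padicValRat.self (p := 2) one_lt_two
  rw [h2] at hle
  push_cast at hle
  linarith

/-- **E-an-71 in the cell's `∀`-form** (an g16 `AtMostOneBlindRoot`, verbatim body): at most one blind rational `2`-torsion point on
a globally minimal `a₁ = a₃ = 0` model. [cite: SilvermanAEC2009, VII.1 (minimal equations) and VIII.8] -/
theorem atMostOneBlindRoot :
    ∀ (W : WeierstrassCurve ℚ) [W.IsElliptic] [W.IsGloballyMinimal], W.a₁ = 0 → W.a₃ = 0 →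
      ∀ (A₂ A₄ A₆ e e' : ℤ), (A₂ : ℚ) = W.a₂ → (A₄ : ℚ) = W.a₄ → (A₆ : ℚ) = W.a₆ → e ≠ e' →
        e ^ 3 + A₂ * e ^ 2 + A₄ * e + A₆ = 0 → e' ^ 3 + A₂ * e' ^ 2 + A₄ * e' + A₆ = 0 →
        KummerBlindAtTwo A₂ A₄ e → ¬ KummerBlindAtTwo A₂ A₄ e' :=
  fun W _ _ ha₁ ha₃ A₂ A₄ A₆ e e' hA₂ hA₄ hA₆ hne he he' hb =>
    not_kummerBlindAtTwo_of_kummerBlindAtTwo_of_ne W ha₁ ha₃ A₂ A₄ A₆ e e' hA₂ hA₄ hA₆ hne he he' hb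

end Summit.BirchSwinnertonDyer.BirchSwinnertonDyer.Theorems.ManinLocalTwoThree

end
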